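import Summits.CriticalPhenomena.PercolationContinuityZ3.Theorems.Transplant.SubdivisionCritical
import Summits.CriticalPhenomena.PercolationContinuityZ3.Theorems.Transplant.StatementBenjaminiSchramm
import Summits.CriticalPhenomena.PercolationContinuityZ3.Theorems.Transplant.DiamondSkeletonConc
import Literature.Probability.Percolation.CriticalContinuityProofs
import Literature.Probability.Percolation.BoundedDegreeCriticalProb
import Literature.Barriers.CriticalPhenomena.SubexponentialGrowthZdProofs
import Literature.Barriers.CriticalPhenomena.AmenableInvariantPercolationZd
import HarnessLib

/-!
# Edge nets inherit the hypotheses of Benjamini–Schramm's Conjecture 4 — scope of the gen-13 subdivision rows: the edge nets of `ℤ^d`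
# (`d ≥ 2`) and of the diamond lattice are genuine (non-vacuous) instances of Conjecture 4

builds on p205010 (kernel theorem, internal audit signed; external expert review pending).
Status sentence (coordinator 2026-08-20T04:30Z): "θ(p_c) = 0 on ℤ^d, all d ≥ 2 — kernel-verified (Lean 4/Mathlib,
standard axioms); internal adversarial audit SIGNED 2026-08-20 04:29Z; external expert review pending."

Lane `prim-bschramm-*`, seat `prim-bschramm-p2` (gen 13).  Companion ("scope/audit") file of `SubdivisionPercolation.lean` /
`SubdivisionCritical.lean` (the series-bond device `G ↦ G^∘ = Subdiv.subdiv G`): automorphisms of `G` act on the edge net (`exists_subdivIso`), so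
`G^∘` is quasi-transitive when `G` is (`subdiv_isQuasiTransitive`; old sites over a fundamental set of `G`, new sites over the bonds at it); with
`subdiv_connected` and `p_c(G^∘) = √p_c(G) ∈ (0,1)` this gives **`zdSubdiv_conj4_hypotheses`** (edge net of `ℤ^d`, `d ≥ 2`: connected,
quasi-transitive, `0 < p_c < 1` at every site) and **`diamondSubdiv_conj4_hypotheses`**, and the binder-shape instances
`conj4_instance_zdSubdiv` / `conj4_instance_diamondSubdiv` of `BenjaminiSchramm1996_conj4` at these graphs, PROVED.
[cite: BenjaminiSchramm1996, Conj. 4 and §2] [cite: FisherEssam1961, §2]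
-/

noncomputable section

namespace Summit.CriticalPhenomena.PercolationContinuityZ3.Theorems.Transplant

open MeasureTheory Literature.Probability.Percolation Literature.Probability.LatticeModels SimpleGraph
open Literature.Barriers.CriticalPhenomena (IsQuasiTransitive zdGraph_connected zdGraph_isQuasiTransitive)

namespace Subdiv

variable {V : Type} {G : SimpleGraph V}

/-! ## §1 Automorphisms of `G` act on the edge net -/

/-- **Automorphisms of `G` act on the edge net**: the relabelling `Equiv.sumCongr γ γ.mapEdgeSet` (old sites by `γ`, the new site on `e`
to the new site on `γ e`) preserves adjacency of `G^∘`.  (Stated as a theorem; the graph isomorphism is assembled inside proofs — no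
definitions in this proof file.) [folklore] -/
theorem subdiv_adj_sumCongr_iff (γ : G ≃g G) (x y : V ⊕ G.edgeSet) :
    (subdiv G).Adj (Equiv.sumCongr γ.toEquiv (Iso.mapEdgeSet γ) x) (Equiv.sumCongr γ.toEquiv (Iso.mapEdgeSet γ) y) ↔
      (subdiv G).Adj x y := by
  cases x with
  | inl a =>
    cases y with
    | inl b => simp
    | inr e =>
      simp only [Equiv.sumCongr_apply, Sum.map_inl, Sum.map_inr, subdiv_adj_inl_inr, Iso.mapEdgeSet_apply,
        Hom.mapEdgeSet_coe, Sym2.mem_map]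
      constructor
      · rintro ⟨b, hb, hba⟩
        have : b = a := γ.injective hba
        rw [← this]; exact hb
      · exact fun h => ⟨a, h, rfl⟩
  | inr e =>
    cases y with
    | inl a =>
      simp only [Equiv.sumCongr_apply, Sum.map_inl, Sum.map_inr, subdiv_adj_inr_inl, Iso.mapEdgeSet_apply,
        Hom.mapEdgeSet_coe, Sym2.mem_map]
      constructor
      · rintro ⟨b, hb, hba⟩
        have : b = a := γ.injective hba
        rw [← this]; exact hb
      · exact fun h => ⟨a, h, rfl⟩
    | inr f => simp

/-- **Every automorphism of `G` lifts to an automorphism of `G^∘`** moving `inl a ↦ inl (γ a)` and the new site on `e` to the new site on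
`γ e`. [folklore] -/
theorem exists_subdivIso (γ : G ≃g G) :
    ∃ Φ : subdiv G ≃g subdiv G, (∀ a : V, Φ (Sum.inl a) = Sum.inl (γ a)) ∧
      ∀ e : G.edgeSet, ∃ f : G.edgeSet, Φ (Sum.inr e) = Sum.inr f ∧ (f : Sym2 V) = Sym2.map γ (e : Sym2 V) :=
  ⟨{ toEquiv := Equiv.sumCongr γ.toEquiv (Iso.mapEdgeSet γ), map_rel_iff' := fun {a b} => subdiv_adj_sumCongr_iff γ a b },
    fun _ => rfl, fun e => ⟨Iso.mapEdgeSet γ e, rfl, rfl⟩⟩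

/-- **The edge net of a locally finite quasi-transitive graph is quasi-transitive** (fundamental set: the old sites of a fundamental set `V₀`
of `G` and the new sites on the bonds at `V₀`). [cite: BenjaminiSchramm1996, §2 (quasi-transitive graphs)] -/
theorem subdiv_isQuasiTransitive [DecidableEq V] [G.LocallyFinite] (h : IsQuasiTransitive G) : IsQuasiTransitive (subdiv G) := by
  classical
  obtain ⟨V₀, hV₀⟩ := h
  have hfin : {f : G.edgeSet | ∃ v ∈ V₀, v ∈ (f : Sym2 V)}.Finite := by
    have h1 : (⋃ v ∈ (V₀ : Set V), (Subtype.val ⁻¹' G.incidenceSet v : Set G.edgeSet)).Finite :=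
      Set.Finite.biUnion V₀.finite_toSet fun v _ => (G.incidenceSet v).toFinite.preimage Subtype.val_injective.injOn
    refine h1.subset ?_
    rintro f ⟨v, hv, hvf⟩
    simp only [Set.mem_iUnion, Set.mem_preimage, Finset.mem_coe, exists_prop]
    exact ⟨v, hv, f.2, hvf⟩
  refine ⟨V₀.image Sum.inl ∪ hfin.toFinset.image Sum.inr, ?_⟩
  rintro (a | e)
  · obtain ⟨γ, hγ⟩ := hV₀ a
    obtain ⟨Φ, hΦl, -⟩ := exists_subdivIso γ
    refine ⟨Φ, Finset.mem_union_left _ ?_⟩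
    rw [hΦl, Finset.mem_image]
    exact ⟨γ a, hγ, rfl⟩
  · obtain ⟨γ, hγ⟩ := hV₀ (endpt e 0)
    obtain ⟨Φ, -, hΦr⟩ := exists_subdivIso γ
    obtain ⟨f, hf, hfe⟩ := hΦr e
    refine ⟨Φ, Finset.mem_union_right _ ?_⟩
    rw [hf, Finset.mem_image]
    refine ⟨f, ?_, rfl⟩
    rw [Set.Finite.mem_toFinset]
    refine ⟨γ (endpt e 0), hγ, ?_⟩
    rw [hfe, Sym2.mem_map]
    exact ⟨endpt e 0, endpt_mem e 0, rfl⟩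

/-- The critical value of a new site is `√` of the parent's critical value at an endpoint of its bond. [cite: FisherEssam1961, §2] -/
theorem criticalProb_subdiv_inr_eq_sqrt [Countable V] [DecidableEq V] [G.LocallyFinite] (e : G.edgeSet) :
    criticalProb (subdiv G) (Sum.inr e) = Real.sqrt (criticalProb G (endpt e 0)) := by
  rw [criticalProb_subdiv_inr e 0, criticalProb_subdiv_inl]

/-- **`0 < p_c(G^∘, u) < 1` at every site of the edge net whenever `0 < p_c(G, v) < 1` at every vertex of `G`.** [cite: FisherEssam1961, §2] -/
theorem criticalProb_subdiv_mem_Ioo [Countable V] [DecidableEq V] [G.LocallyFinite]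
    (h : ∀ v : V, 0 < criticalProb G v ∧ criticalProb G v < 1) (u : V ⊕ G.edgeSet) :
    0 < criticalProb (subdiv G) u ∧ criticalProb (subdiv G) u < 1 := by
  have key : ∀ v : V, 0 < Real.sqrt (criticalProb G v) ∧ Real.sqrt (criticalProb G v) < 1 := fun v =>
    ⟨Real.sqrt_pos.2 (h v).1, by simpa using Real.sqrt_lt_sqrt (criticalProb_mem_Icc G v).1 (h v).2⟩
  rcases u with a | e
  · rw [criticalProb_subdiv_inl]; exact key a
  · rw [criticalProb_subdiv_inr_eq_sqrt]; exact key _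

end Subdiv

open Subdiv

/-! ## §2 The edge net of `ℤ^d` (`d ≥ 2`) — every hypothesis of Conjecture 4 -/

/-- **The edge net of `ℤ^d` (`d ≥ 2`) meets EVERY hypothesis of Benjamini–Schramm's Conjecture 4**: connected, locally finite, quasi-transitive
and `0 < p_c < 1` at every site (`p_c = √p_c(ℤ^d)`). [cite: BenjaminiSchramm1996, Conj. 4] -/
theorem zdSubdiv_conj4_hypotheses (d : ℕ) (hd : 2 ≤ d) :
    (subdiv (zdGraph d)).Connected ∧ Nonempty (subdiv (zdGraph d)).LocallyFinite ∧ IsQuasiTransitive (subdiv (zdGraph d)) ∧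
      ∀ u, 0 < criticalProb (subdiv (zdGraph d)) u ∧ criticalProb (subdiv (zdGraph d)) u < 1 := by
  refine ⟨subdiv_connected (zdGraph_connected d), nonempty_subdiv_locallyFinite, subdiv_isQuasiTransitive (zdGraph_isQuasiTransitive d),
    criticalProb_subdiv_mem_Ioo fun x => ?_⟩
  have hx : criticalProb (zdGraph d) x = criticalProb (zdGraph d) 0 := congrArg Subtype.val (criticalProbIOf_zdGraph_eq d x)
  rw [hx]
  exact ⟨criticalProb_zd_pos d (by omega), criticalProb_zd_lt_one hd⟩

/-- **Conjecture 4 AT the edge net of `ℤ^d` (`d ≥ 2`), in the conjecture's binder shape, PROVED** — builds on p205010 (kernel theorem, internal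
audit signed; external expert review pending). [cite: BenjaminiSchramm1996, Conj. 4] -/
theorem conj4_instance_zdSubdiv (d : ℕ) (hd : 2 ≤ d) :
    (subdiv (zdGraph d)).Connected → IsQuasiTransitive (subdiv (zdGraph d)) →
      ∀ u, criticalProb (subdiv (zdGraph d)) u < 1 → theta (subdiv (zdGraph d)) u (criticalProbIOf (subdiv (zdGraph d)) u) = 0 :=
  fun _ _ u _ => zdSubdiv_criticalContinuity d hd u

/-- The same from the (open) conjecture itself, for comparison of binder shapes (the `LocallyFinite` instance is supplied from
`nonempty_subdiv_locallyFinite`). [cite: BenjaminiSchramm1996, Conj. 4] -/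
theorem zdSubdiv_criticalContinuity_of_conj4 (h : BenjaminiSchramm1996_conj4) (d : ℕ) (hd : 2 ≤ d) (u : Site d ⊕ (zdGraph d).edgeSet) :
    theta (subdiv (zdGraph d)) u (criticalProbIOf (subdiv (zdGraph d)) u) = 0 := by
  haveI : (subdiv (zdGraph d)).LocallyFinite := nonempty_subdiv_locallyFinite.some
  exact h (subdiv (zdGraph d)) (subdiv_connected (zdGraph_connected d)) (subdiv_isQuasiTransitive (zdGraph_isQuasiTransitive d)) u
    ((zdSubdiv_conj4_hypotheses d hd).2.2.2 u).2

/-! ## §3 The edge net of the diamond lattice (idealised β-cristobalite) — every hypothesis of Conjecture 4 -/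

/-- `0 < p_c(diamond, v) < 1` at every vertex (bounded degree; `p_c ≤ 1/2` at the origin, moved by connectedness). [cite: BenjaminiSchramm1996, §2] -/
theorem criticalProb_diamond_mem_Ioo (v : diamondSite) : 0 < criticalProb diamondGraph v ∧ criticalProb diamondGraph v < 1 := by
  classical
  obtain ⟨Δ, hΔ⟩ := diamond_isQuasiTransitive.exists_degree_le
  refine ⟨criticalProb_pos_of_degree_le diamondGraph hΔ v, ?_⟩
  rw [← criticalProb_eq_of_reachable _ (diamondGraph_connected.preconnected diamondOrigin v)]
  exact criticalProb_diamond_lt_one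

/-- **The edge net of the diamond lattice (β-cristobalite Si–O network) meets EVERY hypothesis of Conjecture 4.** [cite: BenjaminiSchramm1996, Conj. 4] -/
theorem diamondSubdiv_conj4_hypotheses :
    (subdiv diamondGraph).Connected ∧ Nonempty (subdiv diamondGraph).LocallyFinite ∧ IsQuasiTransitive (subdiv diamondGraph) ∧
      ∀ u, 0 < criticalProb (subdiv diamondGraph) u ∧ criticalProb (subdiv diamondGraph) u < 1 := by
  classical
  exact ⟨subdiv_connected diamondGraph_connected, nonempty_subdiv_locallyFinite, subdiv_isQuasiTransitive diamond_isQuasiTransitive,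
    criticalProb_subdiv_mem_Ioo criticalProb_diamond_mem_Ioo⟩

/-- **Conjecture 4 AT the edge net of the diamond lattice, in the conjecture's binder shape, PROVED** — builds on p205010 (kernel theorem,
internal audit signed; external expert review pending). [cite: BenjaminiSchramm1996, Conj. 4] -/
theorem conj4_instance_diamondSubdiv :
    (subdiv diamondGraph).Connected → IsQuasiTransitive (subdiv diamondGraph) →
      ∀ u, criticalProb (subdiv diamondGraph) u < 1 → theta (subdiv diamondGraph) u (criticalProbIOf (subdiv diamondGraph) u) = 0 :=
  fun _ _ u _ => diamondSubdiv_criticalContinuity u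

end Summit.CriticalPhenomena.PercolationContinuityZ3.Theorems.Transplant

end
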